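import Summits.QuantumFields.YangMills.Theorems.UnitScaleTiltProp7IterLinStructure
import Literature.MathematicalPhysics.QuantumFieldTheory.Balaban1983to89.B5Eq118OneStroke
import Literature.MathematicalPhysics.QuantumFieldTheory.Balaban1983to89.B15DeterminingSets
import Literature.MathematicalPhysics.QuantumFieldTheory.BalabanImbrieJaffe1984to88.BIJ85AxialPropagator411
import HarnessLib

/-!
# Route `UnitScaleTilt`, crux K1 «MinimiserStabilityRegPr» (stmt-QuantumFields-19200), registered stub `stub_prop7From14` (leaf V3 «Prop 7 from a background (14)») —
# **THE k-FOLD COMB GAUGE: inside print's group (4) at level `k` (`λ = 0` at the k-fold block centres) every fine field can be regauged so that the TRUE k-fold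
# linearised (0.4)-constraint is EXACTLY `L^k` times the STRAIGHT k-fold average `Q_k` of [Balaban1984PropagatorsI] (1.18)** (`exists_combGauge_iterLin`, flat background)

Cell `ym3-torus` ∕ fleet seat `ym-ust-19200-p1` (gen 5).  The one-step statement is `Prop7CombGauge.exists_combGauge_linAvg_eq_smul_bondAvg` (p536205).  Here the k-fold one,
which is what the `ℓ²` assembly on the true fibre reads at the top scale `k = K − n`: by the p2 lineage's structure theorem
`Prop7AvgLinearisation.exists_iterLin_eq_bondAvgIter_sub_grad` (p526009) the k-fold composite `Q^{(k)}` of `linAvg` is `L^kQ_k − dΛ_k` with `Λ_k` a level-`k` site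
function; by [Balaban1984PropagatorsI] (1.20) (`B5Eq120IterProof.bondAvgIter_grad`) `Q_k(dλ) = L^{−k}d(Q′_kλ)`; and `Q′_k` of a POINT MASS is `L^{−kd}` times the
mass at the k-block containing it (`B5Eq118OneStroke.siteAvgIter_eq_blockSum`).  So the gauge function `λ` := the point masses `L^{kd}Λ_k(y)` at the FAR CORNER of each
k-block — never a k-centre, whose offset is at most `(L^k − 1)/2` (`val_embIter_eq`) — satisfies `Q′_kλ = Λ_k`, vanishes at the k-centres, and
`Q^{(k)}Y = L^k·Q_k(Y + dλ)`; moreover `Q^{(k)}(Y + dλ) = Q^{(k)}Y` (`Q^{(k)}(dλ) = d(λ∘embIter_k) = 0`, p2's `iterLin_grad`).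

WHAT IS PROVED (sorry-free, no definition; [folklore] bookkeeping): `iterLin_add` (additivity of any family with the `linAvg` recursion), `val_embIter_eq` (the label of the
k-fold centre: `y·L^k + off`, `2·off + 1 ≤ L^k`), `iterBlockOf_fibreSite` (the k-fold block point of a block site), `siteAvgIter_cornerMass` (`Q′_k` of the corner point
masses), **`exists_combGauge_iterLin`** (the title, with the invariance clause).

References: T. Bałaban, CMP 95 (1984) 17–40 [Balaban1984PropagatorsI] ((1.13), (1.18)–(1.20) pp.19–20); CMP 102 (1985) 277–309 [Balaban1985Variational] ((4) p.278,
(45) p.285); CMP 109 (1987) 249–301 [Balaban1987RG1] ((0.1)–(0.4) p.252).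
-/

noncomputable section

open scoped BigOperators Matrix.Norms.L2Operator Matrix

namespace Summit.QuantumFields.YangMills.Theorems.Prop7CombGauge

open Literature.MathematicalPhysics.QuantumFieldTheory.Balaban1983to89
open Finset T4Continuum AveragingRT BlockAveraging BlockAveragingEMLLinearised LatticeFieldCalculus B5Eq118OneStroke B15DeterminingSets
open Literature.MathematicalPhysics.QuantumFieldTheory.BalabanImbrieJaffe1984to88.BIJ85AxialPropagator411 (bondAvgIter_add)
open Summit.QuantumFields.YangMills.Theorems.Prop7LinAvgOnto (linAvg_add)
open Summit.QuantumFields.YangMills.Theorems.Prop7AvgLinearisation (exists_iterLin_eq_bondAvgIter_sub_grad iterLin_grad)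

variable {P : Params} {n : Type*}

/-! ## §1 Additivity of the k-fold composite -/

/-- Any family with `Q^{(0)} = id`, `Q^{(i+1)} = Q₁∘Q^{(i)}` is additive. [cite: Balaban1985Averaging, (124)-(125) p.36] -/
theorem iterLin_add (Q : (i : ℕ) → (PBond P 0 → Matrix n n ℂ) → PBond P i → Matrix n n ℂ)
    (hQ0 : ∀ Y, Q 0 Y = Y) (hQs : ∀ (i : ℕ) (Y : PBond P 0 → Matrix n n ℂ) (c : PBond P (i + 1)), Q (i + 1) Y c = linAvg (Q i Y) c)
    (Y Z : PBond P 0 → Matrix n n ℂ) : ∀ (k : ℕ) (c : PBond P k), Q k (fun b => Y b + Z b) c = Q k Y c + Q k Z c := by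
  intro k
  induction k with
  | zero => intro c; rw [hQ0, hQ0, hQ0]
  | succ k ih =>
    intro c
    rw [hQs, hQs, hQs, show Q k (fun b => Y b + Z b) = fun b => Q k Y b + Q k Z b from funext ih, linAvg_add]

/-! ## §2 The k-fold centre is never the far corner -/

/-- **THE LABEL OF THE k-FOLD CENTRE**: `(embIter k y)_μ = y_μ·L^k + off` with `2·off + 1 ≤ L^k` (so `off ≤ (L^k − 1)/2`; standing range). [cite: Balaban1987RG1, (0.1) p.252] -/
theorem val_embIter_eq : ∀ (k : ℕ), k ≤ P.m + P.K → ∀ (y : Site P k) (μ : Fin P.d),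
    ∃ off : ℕ, ((embIter k y) μ).val = (y μ).val * P.L ^ k + off ∧ 2 * off + 1 ≤ P.L ^ k
  | 0, _, y, μ => ⟨0, by simp [embIter], by simp⟩
  | k + 1, hk, y, μ => by
    obtain ⟨off, hoff, hle⟩ := val_embIter_eq k (Nat.le_of_succ_le hk) (emb y) μ
    refine ⟨(P.L - 1) / 2 * P.L ^ k + off, ?_, ?_⟩
    · show ((embIter k (emb y)) μ).val = _
      rw [hoff, Site.val_emb hk, pow_succ]
      ring
    · have hL : 1 < P.L := P.hL.2
      have h2 : 2 * ((P.L - 1) / 2) ≤ P.L - 1 := Nat.mul_div_le (P.L - 1) 2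
      have hpos : 0 < P.L ^ k := pow_pos P.L_pos k
      calc 2 * ((P.L - 1) / 2 * P.L ^ k + off) + 1 = (2 * ((P.L - 1) / 2)) * P.L ^ k + (2 * off + 1) := by ring
        _ ≤ (P.L - 1) * P.L ^ k + P.L ^ k := add_le_add (Nat.mul_le_mul_right _ h2) hle
        _ = P.L ^ (k + 1) := by
            rw [pow_succ]
            zify [hL.le]
            ring

/-- The k-fold block point of the block site of offset `r` over `y` is `y`. [cite: Balaban1984PropagatorsI, (1.18) p.20] -/
theorem iterBlockOf_fibreSite {k : ℕ} (hk : k ≤ P.m + P.K) (h : P.sitesPerDir 0 = P.L ^ k * P.sitesPerDir k) (y : Site P k)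
    (r : Fin P.d → Fin (P.L ^ k)) : iterBlockOf k (Site.fibreSite 0 k y r) = y := by
  funext μ
  apply ZMod.val_injective
  rw [val_iterBlockOf k hk, Site.val_fibreSite h, mul_comm, Nat.mul_add_div (pow_pos P.L_pos k), Nat.div_eq_of_lt (r μ).isLt, add_zero]

/-- The k-fold centre is never the far corner of its block (`k ≥ 1`). [cite: Balaban1987RG1, (0.1) p.252] -/
theorem embIter_ne_farCorner {k : ℕ} (hk : k ≤ P.m + P.K) (hk1 : 1 ≤ k) (h : P.sitesPerDir 0 = P.L ^ k * P.sitesPerDir k) (y y' : Site P k) :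
    embIter k y ≠ Site.fibreSite 0 k y' fun _ => ⟨P.L ^ k - 1, Nat.sub_lt (pow_pos P.L_pos k) one_pos⟩ := by
  intro heq
  have μ : Fin P.d := ⟨0, P.hd⟩
  obtain ⟨off, hoff, hle⟩ := val_embIter_eq k hk y μ
  have h2 : ((Site.fibreSite 0 k y' fun _ => (⟨P.L ^ k - 1, Nat.sub_lt (pow_pos P.L_pos k) one_pos⟩ : Fin (P.L ^ k))) μ).val % P.L ^ k = P.L ^ k - 1 := by
    rw [Site.val_fibreSite h, Nat.mul_add_mod', Nat.mod_eq_of_lt (Nat.sub_lt (pow_pos P.L_pos k) one_pos)]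
  have h1 : ((embIter k y) μ).val % P.L ^ k = off := by
    rw [hoff, Nat.mul_add_mod', Nat.mod_eq_of_lt (by omega)]
  rw [heq, h2] at h1
  have hL2 : 2 ≤ P.L ^ k := by
    calc 2 ≤ P.L ^ 1 := by rw [pow_one]; exact P.hL.2
      _ ≤ P.L ^ k := Nat.pow_le_pow_right P.L_pos hk1
  omega

/-! ## §3 `Q′_k` of the corner point masses -/

/-- **`Q′_k` OF THE FAR-CORNER POINT MASSES**: for `λ(x) = L^{kd}·G(y)` at the far corner of `B^k(y)` and `0` elsewhere, `Q′_kλ = G`.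
[cite: Balaban1984PropagatorsI, (1.13), (1.20) pp.19–20] -/
theorem siteAvgIter_cornerMass {k : ℕ} (hk : k ≤ P.m + P.K) (h : P.sitesPerDir 0 = P.L ^ k * P.sitesPerDir k) (G : Site P k → Matrix n n ℂ) (y : Site P k) :
    siteAvgIter k (fun x : Site P 0 => if x = Site.fibreSite 0 k (iterBlockOf k x) (fun _ => ⟨P.L ^ k - 1, Nat.sub_lt (pow_pos P.L_pos k) one_pos⟩)
        then (((P.L : ℝ) ^ P.d) ^ k) • G (iterBlockOf k x) else 0) y = G y := by
  classical
  rw [siteAvgIter_eq_blockSum k hk]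
  have hL : (((P.L : ℝ) ^ P.d) ^ k) ≠ 0 := pow_ne_zero _ (pow_ne_zero _ (Nat.cast_ne_zero.mpr P.L_pos.ne'))
  set x₀ : Site P 0 := Site.fibreSite 0 k y (fun _ => ⟨P.L ^ k - 1, Nat.sub_lt (pow_pos P.L_pos k) one_pos⟩) with hx₀
  have hx₀mem : x₀ ∈ iterBlock k y := by rw [mem_iterBlock, hx₀, iterBlockOf_fibreSite hk h]
  rw [Finset.sum_eq_single_of_mem x₀ hx₀mem]
  · rw [if_pos (by rw [hx₀, iterBlockOf_fibreSite hk h]), hx₀, iterBlockOf_fibreSite hk h, smul_smul, inv_mul_cancel₀ hL, one_smul]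
  · intro x hx hne
    rw [mem_iterBlock] at hx
    rw [hx, if_neg (by rw [← hx₀]; exact hne)]

/-! ## §4 The k-fold comb gauge -/

/-- **THE k-FOLD COMB GAUGE.**  Let `Q^{(i)}` be any family with `Q^{(0)} = id`, `Q^{(i+1)} = Q₁∘Q^{(i)}` (the composite of the true one-step linearisation `linAvg`).
For every `1 ≤ k ≤ m + K` and every fine field `Y` there is a gauge function `λ` VANISHING AT THE k-FOLD CENTRES (the Lie algebra of print's group (4) at level `k`)
with `Q^{(k)}Y = L^k·Q_k(Y + dλ)` EXACTLY, `Q_k = bondAvgIter k` the straight k-fold average (1.18), and `Q^{(k)}(Y + dλ) = Q^{(k)}Y`: the TRUE k-fold linearised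
constraint of `Y` is the STRAIGHT one of a (4)-gauge transform of `Y`. [cite: Balaban1984PropagatorsI, (1.18)-(1.20) p.20; Balaban1985Variational, (4) p.278, (45) p.285] -/
theorem exists_combGauge_iterLin (Q : (i : ℕ) → (PBond P 0 → Matrix n n ℂ) → PBond P i → Matrix n n ℂ)
    (hQ0 : ∀ Y, Q 0 Y = Y) (hQs : ∀ (i : ℕ) (Y : PBond P 0 → Matrix n n ℂ) (c : PBond P (i + 1)), Q (i + 1) Y c = linAvg (Q i Y) c)
    {k : ℕ} (hk : k ≤ P.m + P.K) (hk1 : 1 ≤ k) (h : P.sitesPerDir 0 = P.L ^ k * P.sitesPerDir k) (Y : PBond P 0 → Matrix n n ℂ) :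
    ∃ lam : Site P 0 → Matrix n n ℂ, (∀ y : Site P k, lam (embIter k y) = 0) ∧
      (∀ c : PBond P k, Q k Y c = (P.L ^ k : ℕ) • bondAvgIter k (fun b => Y b + (lam b.tgt - lam b.src)) c) ∧
      ∀ c : PBond P k, Q k (fun b => Y b + (lam b.tgt - lam b.src)) c = Q k Y c := by
  classical
  obtain ⟨Λ, hΛ⟩ := exists_iterLin_eq_bondAvgIter_sub_grad Q hQ0 hQs Y k hk
  -- the corner point masses `−L^{kd}·Λ`
  set lam : Site P 0 → Matrix n n ℂ := fun x => if x = Site.fibreSite 0 k (iterBlockOf k x) (fun _ => ⟨P.L ^ k - 1, Nat.sub_lt (pow_pos P.L_pos k) one_pos⟩)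
      then (((P.L : ℝ) ^ P.d) ^ k) • (fun y => -Λ y) (iterBlockOf k x) else 0 with hlam
  have hcentre : ∀ y : Site P k, lam (embIter k y) = 0 := fun y => by
    rw [hlam]; exact if_neg (embIter_ne_farCorner hk hk1 h y _)
  have hQ' : siteAvgIter k lam = fun y => -Λ y := funext fun y => siteAvgIter_cornerMass hk h (fun y => -Λ y) y
  -- `L^k·Q_k(dλ) = −dΛ`
  have hgrad : ∀ c : PBond P k, (P.L ^ k : ℕ) • bondAvgIter k (fun b : PBond P 0 => lam b.tgt - lam b.src) c = -(Λ c.tgt - Λ c.src) := by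
    intro c
    have hg : (fun b : PBond P 0 => lam b.tgt - lam b.src) = grad 1 lam := by funext b; rw [grad, one_smul]
    rw [hg, B5Eq120IterProof.bondAvgIter_grad k hk 1 lam, hQ', grad, ← Nat.cast_smul_eq_nsmul ℝ, smul_smul]
    have : ((P.L ^ k : ℕ) : ℝ) * (1 / (P.L : ℝ) ^ k) = 1 := by
      rw [Nat.cast_pow, mul_one_div, div_self (pow_ne_zero _ (Nat.cast_ne_zero.mpr P.L_pos.ne'))]
    rw [this, one_smul]
    abel
  refine ⟨lam, hcentre, fun c => ?_, fun c => ?_⟩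
  · rw [hΛ c, show (fun b : PBond P 0 => Y b + (lam b.tgt - lam b.src)) = Y + (fun b : PBond P 0 => lam b.tgt - lam b.src) from rfl,
      bondAvgIter_add, Pi.add_apply, smul_add, hgrad]
    abel
  · rw [iterLin_add Q hQ0 hQs Y (fun b => lam b.tgt - lam b.src) k c,
      iterLin_grad Q hQ0 hQs (fun i φ y => φ (embIter i y)) (fun φ => rfl) (fun i φ y => rfl) lam k c, hcentre, hcentre, sub_self, add_zero]

end Summit.QuantumFields.YangMills.Theorems.Prop7CombGauge

end
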